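import Literature.Barriers.HodgeConjecture.KaehlerCounterexamplesSkewTorus
import Literature.Barriers.HodgeConjecture.KaehlerCounterexamplesLiftProofs
import Literature.Geometry.Kaehler.ComplexTorusZuckerNoCurves
import Literature.Geometry.Kaehler.HolomorphicOrderAlongHypersurface
import Literature.Geometry.Kaehler.AnalyticSetRegularUnion
import Literature.NumberTheory.Transcendental.DeRhamTheoremProofs
import HarnessLib

/-!
# Barrier fact `Zucker1977_kaehlerTorus_noAnalyticCycles` HOLDS

Discharge of the named barrier fact
`Literature.Barriers.HodgeConjecture.Zucker1977_kaehlerTorus_noAnalyticCycles`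
(`KaehlerCounterexamples.lean`; S. Zucker, *The Hodge conjecture for cubic fourfolds*, Compositio Math.
34 (1977), Appendix B, Theorem p. 208 for `n = 1`: there is a compact connected Kähler surface with a
non-zero integral class of type `(1,1)` and NO analytic hypersurface — "even the Lefschetz theorem for
divisors is false on general Kähler manifolds").

`KaehlerCounterexamplesSkewTorus.lean` reduced the fact to two leaves on the explicit general `J`-torus
`T₀ = ℂ²/L₀` (`ComplexTorus Zucker.skewPeriodCLE`, skew `J`-lattice `v₁ = (1,1)`, `v₂ = (√2, √3)`),
`Zucker1977_kaehlerTorus_noAnalyticCycles_of_skewLattice`: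

1. de Rham's theorem with complex coefficients on `ℂ²`, `exists_complexDeRhamIsoFamily (Fin 2 → ℂ)` — proved
   in the tree (`Literature.NumberTheory.Transcendental.exists_complexDeRhamIsoFamily_holds`, integration over
   smooth singular simplices);
2. `T₀` contains no analytic hypersurface (`IsAnalyticHypersurface`: closed, non-empty, locally the zero set
   of one holomorphic function not vanishing identically) — ZUCKER'S THEOREM proper, now proved in
   `Literature/Geometry/Kaehler/ComplexTorusZuckerNoCurves.lean` (`Zucker.not_hasPureCodim_one`: no closed
   analytic subset of pure codimension one, via the cycle classes of analytic curves (Lelong positivity,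
   rows A2/A4 of lane `lit-hodgefound`), the cohomological form of Zucker's Proposition, and
   "no effective analytic cycle is homologous to zero on a compact Kähler manifold").

This file supplies the bridge between the barrier file's elementary notion `IsAnalyticHypersurface` and
the analytic-set layer (`IsAnalyticHypersurface.hasPureCodim_one`: an analytic hypersurface is an analytic
subset of PURE CODIMENSION ONE — a regular point has codimension `≤ 1` by the second Riemann extension
theorem, tree `codim_le_one_of_isRegularPointOfCodim_of_eq_setOf`, and `≥ 1` because a hypersurface has
empty interior), and assembles **`Zucker1977_kaehlerTorus_noAnalyticCycles_holds`**. Theorems only; the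
fact's net debt goes from `1` to `0`.

## References

* [Zucker1977] S. Zucker, Compositio Math. 34 (1977) 199–209, Appendix B, Proposition p. 207, Theorem p. 208.
* [Voisin2002KaehlerCounterexample] C. Voisin, IMRN 2002 no. 20, §1.
* [GriffithsHarrisPrinciples1978] P. Griffiths, J. Harris, Principles of Algebraic Geometry (1978), Ch. 0 §1–§2
  (analytic hypersurfaces; smooth points have codimension one).
-/

noncomputable section

open scoped Manifold Topology
open Set

universe u

namespace Literature.Barriers.HodgeConjecture

open Literature.Geometry.Kaehler Literature.NumberTheory.Transcendental

section Bridge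

variable {E : Type u} [NormedAddCommGroup E] [NormedSpace ℂ E] [FiniteDimensional ℂ E]
variable {M : Type u} [TopologicalSpace M] [ChartedSpace E M] [IsManifold 𝓘(ℂ, E) 1 M]

/-- **A regular point of an analytic hypersurface has codimension exactly one**: `≤ 1` since `Z` is
locally the zero set of ONE holomorphic function (second Riemann extension theorem,
`codim_le_one_of_isRegularPointOfCodim_of_eq_setOf`), `≥ 1` since a point of codimension `0` would be
interior (`IsRegularPointOfCodim.mem_interior`) while an analytic hypersurface has empty interior.
[cite: GriffithsHarrisPrinciples1978, Ch. 0 §2] -/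
theorem IsAnalyticHypersurface.codim_eq_one {Z : Set M} (hZ : IsAnalyticHypersurface (E := E) Z)
    {x : M} (hx : x ∈ Z) {c : ℕ} (hc : IsRegularPointOfCodim 𝓘(ℂ, E) Z c x) : c = 1 := by
  obtain ⟨U, hU, hxU, f, hf, -, hZU⟩ := hZ.2.2 x hx
  have hZU' : Z ∩ U = {y ∈ U | f y = 0} := by
    rw [hZU]; ext y; simp only [mem_inter_iff, mem_preimage, mem_singleton_iff, mem_setOf_eq]
  have hle : c ≤ 1 := codim_le_one_of_isRegularPointOfCodim_of_eq_setOf hU hf hZU' hxU hx hc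
  have hne : c ≠ 0 := by
    rintro rfl
    have hint : x ∈ interior Z := hc.mem_interior
    rw [hZ.interior_eq_empty] at hint
    exact hint
  omega

/-- **An analytic hypersurface is an analytic subset of pure codimension one** (`HasPureCodim 𝓘(ℂ, E) Z 1`:
analytic, non-empty, every regular point regular of codimension `1`) — the bridge from the elementary
notion of `KaehlerCounterexamples.lean` to the analytic-set layer `Geometry/Kaehler/AnalyticSet`.
[cite: GriffithsHarrisPrinciples1978, Ch. 0 §1–§2] -/
theorem IsAnalyticHypersurface.hasPureCodim_one {Z : Set M} (hZ : IsAnalyticHypersurface (E := E) Z) :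
    HasPureCodim 𝓘(ℂ, E) Z 1 := by
  refine ⟨hZ.isAnalyticSet, hZ.2.1, fun x hx ↦ ?_⟩
  obtain ⟨hxZ, c, hc⟩ := hx
  rwa [hZ.codim_eq_one hxZ hc] at hc

/-- Dimension form: an analytic hypersurface of a manifold charted on `E` has pure dimension `dim E - 1`.
[cite: GriffithsHarrisPrinciples1978, Ch. 0 §1–§2] -/
theorem IsAnalyticHypersurface.hasPureDim {Z : Set M} (hZ : IsAnalyticHypersurface (E := E) Z) {d : ℕ}
    (hd : d + 1 = Module.finrank ℂ E) : HasPureDim 𝓘(ℂ, E) Z d :=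
  ⟨1, hd, hZ.hasPureCodim_one⟩

end Bridge

/-- **Leaf (2) for `T₀`: the explicit general `J`-torus `T₀ = ℂ²/L₀` contains no analytic hypersurface**
(Zucker's Theorem p. 208, `Zucker.not_hasPureCodim_one` of `ComplexTorusZuckerNoCurves`, through the bridge
`IsAnalyticHypersurface.hasPureCodim_one`). [cite: Zucker1977, Appendix B Theorem p. 208]
[cite: Voisin2002KaehlerCounterexample, §1] -/
theorem not_isAnalyticHypersurface_skewTorus (Z : Set (ComplexTorus Zucker.skewPeriodCLE)) :
    ¬ IsAnalyticHypersurface (E := Fin 2 → ℂ) Z :=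
  fun hZ ↦ Zucker.not_hasPureCodim_one Z hZ.hasPureCodim_one

/-- **THE BARRIER FACT `Zucker1977_kaehlerTorus_noAnalyticCycles` HOLDS**: there is a compact connected Kähler
surface (`T₀ = ℂ²/L₀`) carrying a non-zero integral class of type `(1,1)` and no analytic hypersurface —
assembled from de Rham's theorem on `ℂ²` (`exists_complexDeRhamIsoFamily_holds`) and Zucker's Theorem for
`T₀` (`not_isAnalyticHypersurface_skewTorus`) by `Zucker1977_kaehlerTorus_noAnalyticCycles_of_skewLattice`.
[cite: Zucker1977, Appendix B Theorem p. 208] [cite: Voisin2002KaehlerCounterexample, §1]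
[cite: Deligne2000, §2 Remark (v)] -/
theorem Zucker1977_kaehlerTorus_noAnalyticCycles_holds : Zucker1977_kaehlerTorus_noAnalyticCycles :=
  Zucker1977_kaehlerTorus_noAnalyticCycles_of_skewLattice (exists_complexDeRhamIsoFamily_holds (Fin 2 → ℂ))
    not_isAnalyticHypersurface_skewTorus

/-- Consequently the technique class is refuted unconditionally: Kähler analytic-hypersurface methods do NOT
detect integral `(1,1)`-classes on compact Kähler surfaces charted on `ℂ²`
(`not_kaehlerAnalyticHypersurfacesDetectClasses` fed with the fact).
[cite: Zucker1977, Appendix B Theorem p. 208] [cite: Voisin2002KaehlerCounterexample, §1] -/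
theorem not_kaehlerAnalyticHypersurfacesDetectClasses_holds :
    ¬ KaehlerAnalyticHypersurfacesDetectClasses (Fin 2 → ℂ) :=
  not_kaehlerAnalyticHypersurfacesDetectClasses Zucker1977_kaehlerTorus_noAnalyticCycles_holds

end Literature.Barriers.HodgeConjecture

end
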